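import Literature.MathematicalPhysics.QuantumFieldTheory.Balaban1983to89.B1LowerBound

/-!
# `Balaban1983to89.B1Ineq337Proof` — T. Bałaban, *(Higgs)₂,₃ quantum fields in a finite volume. I. A lower bound*,
Commun. Math. Phys. **85** (1982) 603–626 [Balaban1982Higgs1]: **(3.37)** p. 618 — *"From (3.26) and (2.9) we have"* the lower
bound of `Z^ε` by the `(k+1)`-st double renormalization transformation of the cut-off k-th density with the new cut-offs
`χ_{k+1}(B)χ_{k+1}(ψ)` inserted — PROVED from the induction hypothesis of record `B1LowerBound.IndHyp326` and the
integral-preservation (2.9) of the transformation (displayed as the hypothesis it is; kernel-checked for the tree's kernels in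
`B1RT.integral_rtOp` / `B1Ineq36LowerStep`); theorems only

statement-level skeleton of published theorems with citation tags; proofs where landed; nothing here is a claim about the Yang–Mills mass gap

PDF held: `paper:balaban1982-cmp85-higgs23-i` (journal page = PDF page + 602); (3.26) p. 617 and (3.37) p. 618 READ AS IMAGES on
the x2 renders `run/shared/lean/pub/pub-balaban/b2b-balaban-ref1/pages/1982-cmp85-higgs23-I/…-p015-x2.png`, `…-p016-x2.png`;
(2.9) p. 609 `…-p007-x2.png`.

CITATION HEADER (lean-in-tree rule).  WHAT IS REPRODUCED — SKELETON row **B1.Eq3.37–3.38**, the (3.37) member (reader r12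
`lit-balaban-r12/ROWS-B1-part2.md`: «(3.26)+(2.9) ⇒ the (k+1)-st step integral; rescaled to the unit lattice (3.38); absent ·
integral expressions»; the rescaling (3.38) is NOT treated here).  Verbatim, p. 618 [PDF 16]: *"Now we will consider a general
case, i.e. all the operations to be done after k+1^{st} application of the renormalization transformation. From (3.26) and
(2.9) we have Z^ε ≥ ∫dB∫dψ χ_{k+1}(B)χ_{k+1}(ψ)T^{L^kε}_{a,L}[T^{L^kε}_{a,L,A^{(k),ε}}[χ_k(A)χ_k(φ)·exp(−S^{(k),L^kε}(A, φ))]]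
exp(Σ_{j=0}^{k−1} O(1)(L^jε)^{κ₀}|T_ε|) (3.37) and we have to calculate the internal integral above."*; (3.26) p. 617: *"Z^ε ≥
∫dA∫dφ χ_k(A)χ_k(φ)exp(−S^{(k),L^kε}(A, φ) + Σ_{j=0}^{k−1} O(1)(L^jε)^{κ₀}|T_ε|) (3.26)"*; (2.9) p. 609: *"∫dψ ρ′(A,ψ) =
∫dφ ρ(A,φ)"*.

THE MODEL.  The run carrier of record `B1LowerBound.Run326` (numbers `Z` ↤ `Z^ε`, `intK k` ↤ the k-th cut-off integral
`∫dA∫dφ χ_k(A)χ_k(φ)exp(−S^{(k),L^kε})`, `eps, L, K, vol`) and its induction hypothesis `IndHyp326` (the `O(1)`-sum read as a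
lower bound `exp(−CΣ_{j<k}(L^jε)^{κ₀}|T_ε|)`); the fields of step k form an arbitrary measure space `(Ω, μ)` (↤ `(A, φ)` with
`dA dφ`), the block fields `(Ω′, ν)` (↤ `(B, ψ)` with `dB dψ`); `F` ↤ the cut-off density `χ_k(A)χ_k(φ)exp(−S^{(k)})`, linked to
the carrier by the DICTIONARY hypothesis `intK k = ∫F dμ`; `T` ↤ the double transformation `T^{L^kε}_{a,L}T^{L^kε}_{a,L,A^{(k)}}`
acting on densities, with its two printed properties as hypotheses: (2.9) `∫(T F) dν = ∫F dμ` and positivity `T F ≥ 0`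
(for the tree's Gaussian block kernels these are `B1RT.integral_rtOp` and `B1Ineq36LowerStep.integral_kernel_mul_nonneg`);
`χ′` ↤ `χ_{k+1}(B)χ_{k+1}(ψ)` with values in `[0,1]`.

WHAT THIS FILE PROVES (theorems only — no `def`, no new `Prop` fact; 0 `sorry`; standard axioms):
* `integral_cutoff_transf_le` — `∫dν χ′·(T F) ≤ ∫dμ F` from (2.9), `T F ≥ 0` integrable and `0 ≤ χ′ ≤ 1`;
* **`ineq337`** — one run, one step `k ≤ K`: `(3.26) at k` ∧ the above ⇒ `Z^ε ≥ (∫dB dψ χ_{k+1}χ_{k+1}·T[χ_kχ_k e^{−S^{(k)}}])·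
  exp(−CΣ_{j<k}(L^jε)^{κ₀}|T_ε|)` — (3.37); **`ineq337_family`** — the same from `B1LowerBound.IndHyp326 fam` for every run of a
  family and every `k ≤ K`, with the family's constants `C, κ₀ > 0`.
HONEST SCOPE.  (2.9) and positivity are hypotheses here (displayed); the content kernel-checked is the insertion of the new
cut-offs and the composition with (3.26), i.e. exactly the sentence *"From (3.26) and (2.9) we have (3.37)"*.
Unit `lit-balaban-p14` gen 3 (Phase-2 proof seat p14, literature-prover-lit-balaban-p14-g3-0), HOME
`run/shared/lean/pub/lit-balaban/` (seat log `lit-balaban-p14/STATUS.md`).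
-/

namespace Literature.MathematicalPhysics.QuantumFieldTheory.Balaban1983to89.B1Ineq337Proof

open Literature.MathematicalPhysics.QuantumFieldTheory.Balaban1983to89
open B1LowerBound MeasureTheory Finset

section Step

variable {Ω Ω' : Type*} [MeasurableSpace Ω] [MeasurableSpace Ω'] (μ : Measure Ω) (ν : Measure Ω')

/-- Inserting the new cut-offs `χ_{k+1}(B)χ_{k+1}(ψ) ∈ [0,1]` against the non-negative transformed density and using (2.9):
`∫dBdψ χ′·T[F] ≤ ∫dBdψ T[F] = ∫dAdφ F`. [cite: Balaban1982Higgs1, (3.37) p.618] -/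
theorem integral_cutoff_transf_le (T : (Ω → ℝ) → Ω' → ℝ) {F : Ω → ℝ} (h29 : ∫ b, T F b ∂ν = ∫ a, F a ∂μ)
    (hT0 : ∀ b, 0 ≤ T F b) (hTint : Integrable (T F) ν) {χ' : Ω' → ℝ} (hχ' : ∀ b, χ' b ∈ Set.Icc (0 : ℝ) 1) :
    ∫ b, χ' b * T F b ∂ν ≤ ∫ a, F a ∂μ := by
  rw [← h29]
  exact integral_mono_of_nonneg (Filter.Eventually.of_forall fun b => mul_nonneg (hχ' b).1 (hT0 b)) hTint
    (Filter.Eventually.of_forall fun b => mul_le_of_le_one_left (hT0 b) (hχ' b).2)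

/-- **(3.37) p. 618** for one run `R` and one step `k ≤ K`: from (3.26) at `k` in its typed form
(`intK k · exp(−CΣ_{j<k}(L^jε)^{κ₀}|T_ε|) ≤ Z^ε`), the dictionary `intK k = ∫dAdφ χ_kχ_k e^{−S^{(k)}} = ∫F dμ`, the
integral-preservation (2.9) of the double transformation `T` and `T F ≥ 0`:
`(∫dBdψ χ_{k+1}(B)χ_{k+1}(ψ)·T[χ_kχ_k exp(−S^{(k)})])·exp(−CΣ_{j<k}(L^jε)^{κ₀}|T_ε|) ≤ Z^ε`.
[cite: Balaban1982Higgs1, (3.37) p.618] -/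
theorem ineq337 (R : Run326) {C κ₀ : ℝ} (k : ℕ)
    (h326 : R.intK k * Real.exp (-(C * (∑ i ∈ range k, (R.L ^ i * R.eps) ^ κ₀) * R.vol)) ≤ R.Z)
    (T : (Ω → ℝ) → Ω' → ℝ) {F : Ω → ℝ} (hdict : R.intK k = ∫ a, F a ∂μ) (h29 : ∫ b, T F b ∂ν = ∫ a, F a ∂μ)
    (hT0 : ∀ b, 0 ≤ T F b) (hTint : Integrable (T F) ν) {χ' : Ω' → ℝ} (hχ' : ∀ b, χ' b ∈ Set.Icc (0 : ℝ) 1) :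
    (∫ b, χ' b * T F b ∂ν) * Real.exp (-(C * (∑ i ∈ range k, (R.L ^ i * R.eps) ^ κ₀) * R.vol)) ≤ R.Z := by
  refine le_trans ?_ h326
  rw [hdict]
  exact mul_le_mul_of_nonneg_right (integral_cutoff_transf_le μ ν T h29 hT0 hTint hχ') (Real.exp_nonneg _)

end Step

/-- **(3.37) along a family of runs** from the induction hypothesis of record `B1LowerBound.IndHyp326 fam` (ONE `C` and ONE
`κ₀ > 0` for all runs and all steps `k ≤ K`): for every run `j`, every `k ≤ K_j`, every realisation of the k-th cut-off
integral as `∫F dμ` and every double transformation `T` with (2.9) and positivity, the (3.37) bound holds with those constants.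
[cite: Balaban1982Higgs1, (3.37) p.618] -/
theorem ineq337_family {J : Type} (fam : J → Run326) (h : IndHyp326 fam) :
    ∃ C κ₀ : ℝ, 0 < κ₀ ∧ ∀ (j : J) (k : ℕ), k ≤ (fam j).K →
      ∀ {Ω Ω' : Type} [MeasurableSpace Ω] [MeasurableSpace Ω'] (μ : Measure Ω) (ν : Measure Ω')
        (T : (Ω → ℝ) → Ω' → ℝ) (F : Ω → ℝ) (χ' : Ω' → ℝ),
        (fam j).intK k = ∫ a, F a ∂μ → ∫ b, T F b ∂ν = ∫ a, F a ∂μ → (∀ b, 0 ≤ T F b) → Integrable (T F) ν →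
        (∀ b, χ' b ∈ Set.Icc (0 : ℝ) 1) →
          (∫ b, χ' b * T F b ∂ν)
              * Real.exp (-(C * (∑ i ∈ range k, ((fam j).L ^ i * (fam j).eps) ^ κ₀) * (fam j).vol))
            ≤ (fam j).Z := by
  obtain ⟨C, κ₀, hκ₀, hall⟩ := h
  exact ⟨C, κ₀, hκ₀, fun j k hk _ _ _ _ μ ν T _ _ hdict h29 hT0 hTint hχ' =>
    ineq337 μ ν (fam j) k (hall j k hk) T hdict h29 hT0 hTint hχ'⟩

end Literature.MathematicalPhysics.QuantumFieldTheory.Balaban1983to89.B1Ineq337Proof
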